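import Summits.QuantumFields.BalabanUV.Beta.FP.MixLoopInstanceBlockFamily
import Summits.QuantumFields.BalabanUV.Beta.FP.MixLoopPowerCountingGamma

/-!
# `Beta/FP/MixLoopInstanceBlockFamilyField` — road «FP» (binder row D1), row **RHOA-6e** piece instances: THE FIELD SIDE OF THE ROOTED BLOCK FAMILY —
# the ALL-BLOCKS field-point count `Σ_u wfld^{(u)}(c) ≤ N⁻⁴·Σ_σ p σ` and the Γ₀-profile-windowed FIELD-POINT mass letter (M̃Γ) of RHOA-6c′'s (MIX-1) engine
# `MixLoopPowerCountingMassGamma.coarse_mix1_secondMoment_le`, DISCHARGED for `ker₁ (blkW N p) (blkFld N μ u) (blkBg N μ u rad id)` with every power of `N` displayed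
# ([folklore] index plumbing on `ℤ⁴`; no road object identified)

HONEST FRAMING (cell `pub-balaban`, β sub-cell, verbatim): discharging `BetaPertH` makes Bałaban's UV stability UNCONDITIONAL — a real constructive-QFT
result; it is NOT the continuum limit and NOT the Clay problem.  THIS MODULE is [folklore] finite-sum plumbing composed BY NAME with ACCEPTED road theorems:
`AveragingJetLetters.base_unique` (uniqueness of the block decomposition), `AveragingJetLettersRooted.sum_ker₁_le_mul_wfld`∕`length_blkBg_le` (RHOA-6b′), FILE A∕B's
engines `MixLoopPowerCounting.sum_exp_le` (`j = 3`) and `MixLoopPowerCountingGamma.sum_inv_sq_mul_exp_le` (`j = 1`).  It asserts nothing about Bałaban's objects, cites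
nothing, mints no `Prop` fact, has no `def`, 0 sorry.  NOT `Mix_n = O(1)`, NOT the (rem) packaging (owner LEDGER), NOT hbook, NOT D1, NOT BetaPertH, NOT continuum, NOT Clay.
HONEST DEPENDENCY: continuum YM on T⁴ ⇐ BetaPertH ∧ nine spine estimates (0/9 proved); BetaPertH ⇐ (D1) ∧ (D4) ∧ CAP+tail; G-an2-4 gates asym, D1 and NE2/3/4.

ABSOLUTE RULE (cell charter, verbatim): «No internally-minted statement may enter as a cited fact. Every hypothesis is either kernel-proved in this package or a
verbatim quotation of a PUBLISHED theorem with page reference. The manuscript(s) under audit are NOT citable for their own disputed steps — they are the thing under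
adjudication; programme-internal (2001/route/tribunal) claims are never citable.»

WHY (`MixLoopPowerCountingMassGamma` header, verbatim): the (MIX-1) majorant «is written with both masses INLINE and two windowed letters: the owner's (M) on the
insertion side and the Γ₀-PROFILE-WINDOWED FIELD-POINT MASS (M̃Γ) on the field side».  (M) for the block family is `MixLoopInstanceBlockFamily.windowedMass_blk_le`
(p247290); (M̃Γ) needs the FIELD-side analogue — «a `WindowedBlockMass`-type lemma for `wfld` on the straight segments» — which is this file.  The one new
count: the straight-segment field legs of DIFFERENT blocks share a fine point at most `N` times IN TOTAL (pairs `(u, (x′, s))` with `N•u + x′ + s·e_μ = c` inject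
into `s < N` by `base_unique`), so `Σ_{u∈Y} wfld^{(u)}(c) ≤ N⁻⁵·Σp·N = N⁻⁴·Σp` for EVERY finite coarse set `Y` — the single-block letter `wfld_blk_le` summed for free.

CONTENT (`N ≥ 1`, direction `μ`, probabilities `p σ ≥ 0` FREE, radial words `rad σ u x′ : List Pt` of length `≤ ℓ₀`, point labels `strB = id`; NO radius letter is used here):
* §1 **`sum_wfld_blk_le`** (`Σ_{u∈Y} wfld (blkW N p) (blkFld N μ u) c ≤ N⁻⁴·Σ_σ p σ`, every finite `Y`, every `c`) and **`sum_sum_ker₁_blk_le`**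
  (`Σ_{u∈Y} Σ_{b∈S} ker₁^{(u)} b c ≤ (ℓ₀+N)·N⁻⁴·Σp`, every finite `Y`, `S`, every field point `c`).
* §2 `sum_profile_half_le` (the (MIX-1) field profile `((‖y‖∞+1)⁻² + N⁻²)·e^{−(δ∕(2N))‖y‖∞}` summed over ANY finite set: `≤ P(δ)·N²`,
  `P(δ) = (1 + 80e^{δ∕4}(4∕δ)²) + (1 + 480e^{δ∕4}(4∕δ)⁴)`, engines BY NAME at rate `δ∕2`) and **`windowedFieldMass_blk_le`** = (M̃Γ) FOR THE BLOCK FAMILY: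
  `∀ c, Σ_{b′∈S} Σ_{w′∈W} ((‖c−(b′+w′)‖∞+1)⁻² + N⁻²)·e^{−(δ∕(2N))‖c−(b′+w′)‖∞}·(Σ_{u′∈U b′}|ker₁^{(u′)} b′ (b′+w′)|) ≤ Ã := ((ℓ₀+N)·(N⁻⁴·Σp))·(P(δ)·N²)` for ANY
  `U : Pt → Finset Pt` and ALL finite `S`, `W` (reindex `w′ ↦ c′ = b′ + w′`, enlarge to the finite field window `S.biUnion (W.image (b′ + ·))`, swap, §1, then §2's
  profile sum ONCE on the reflected window) — i.e. `Ã ≍ (ℓ₀+N)·N⁻²·Σp` × δ-numbers, every power of `N` displayed.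
Consumer: `MixLoopInstanceBlockFamilyGamma` (the (MIX-1) block-family END).  Provenance: cross-cell idle-seat kernel duty NE7b → β∕D1, unit
`b2b-balaban-t4-ne7b-formalise-leaf-02` gen 23 (prover-…-leaf-02-g23-0), 2026-08-21, INTENT O-ne7bleaf02g23-1 (journal l.26874) under R-FP-33 (c) «the remaining
piece instances»; «not in print; our bookkeeping»; no existing file touched.
-/

noncomputable section

namespace Summit.QuantumFields.BalabanUV.Beta.FP.MixLoopInstanceBlockFamilyField

open Finset Real
open scoped BigOperators
open Literature.MathematicalPhysics.QuantumFieldTheory.Balaban1983to89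
open Literature.MathematicalPhysics.QuantumFieldTheory.Balaban1983to89.Beta
open DyadicShell (Pt supNorm)
open AxialBlockWeights (idx pt)
open Summit.QuantumFields.BalabanUV.Beta.FP.AveragingJetLetters (mem_idx_iff base_unique)
open Summit.QuantumFields.BalabanUV.Beta.FP.AveragingJetLettersRooted (wfld ker₁ blkW blkFld blkBg blkW_nonneg ker₁_nonneg
  sum_ker₁_le_mul_wfld length_blkBg_le)
open Summit.QuantumFields.BalabanUV.Beta.FP.MixLoopPowerCounting (sum_exp_le supNorm_cast_nonneg)
open Summit.QuantumFields.BalabanUV.Beta.FP.MixLoopPowerCountingGamma (sum_inv_sq_mul_exp_le)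

section Block

variable {σ : Type*} [Fintype σ] {N : ℕ} {μ : Fin 4} {p : σ → ℝ} {rad : σ → Pt → Pt → List Pt} {ℓ₀ : ℕ}

/-! ## §1 The all-blocks field-point count -/

/-- [folklore] **THE PAIRS `(u, q)` WHOSE STRAIGHT BOND IS `c` INJECT INTO THE POSITION `s < N`**: for every finite coarse set `Y` and every fine point `c`,
`Σ_{u∈Y} #{q ∈ idx N : N•u + pt μ q = c} ≤ N` (`base_unique`: same position ⟹ same block and same block point). -/
theorem sum_card_fiber_blk_le (Y : Finset Pt) (c : Pt) :
    ∑ u ∈ Y, (Finset.univ.filter (fun q : ↥(idx N) => N • u + pt μ q.1 = c)).card ≤ N := by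
  classical
  rw [← Finset.card_sigma]
  calc (Y.sigma fun u => Finset.univ.filter (fun q : ↥(idx N) => N • u + pt μ q.1 = c)).card
      ≤ (Finset.range N).card := by
        refine Finset.card_le_card_of_injOn (fun x => x.2.1.2) (fun x hx => ?_) (fun x hx x' hx' h => ?_)
        · have hq := (mem_idx_iff.mp x.2.2).2
          exact Finset.mem_coe.mpr (Finset.mem_range.mpr hq)
        · have hxc : N • x.1 + pt μ x.2.1 = c := (Finset.mem_filter.mp (Finset.mem_sigma.mp (Finset.mem_coe.mp hx)).2).2
          have hxc' : N • x'.1 + pt μ x'.2.1 = c := (Finset.mem_filter.mp (Finset.mem_sigma.mp (Finset.mem_coe.mp hx')).2).2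
          have hj : x.2.1.2 = x'.2.1.2 := h
          have hb1 := (mem_idx_iff.mp x.2.2).1
          have hb2 := (mem_idx_iff.mp x'.2.2).1
          have e1 : pt μ x.2.1 = pt μ (x.2.1.1, x.2.1.2) := rfl
          have e2 : pt μ x'.2.1 = pt μ (x'.2.1.1, x.2.1.2) := by rw [hj]
          rw [e1] at hxc
          rw [e2] at hxc'
          obtain ⟨hu, hx1⟩ := base_unique hb1 hb2 (hxc.trans hxc'.symm)
          have hq : x.2 = x'.2 := Subtype.ext (Prod.ext hx1 hj)
          exact Sigma.ext hu (heq_of_eq hq)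
    _ = N := Finset.card_range N

/-- **THE ALL-BLOCKS FIELD-POINT COUNT** ([folklore]): `Σ_{u∈Y} wfld (blkW N p) (blkFld N μ u) c ≤ N⁻⁴·Σ_σ p σ` for EVERY finite coarse set `Y` and every fine
point `c` (`p ≥ 0`, `N ≥ 1`) — the single-block letter `AveragingJetLettersRooted.wfld_blk_le` holds SUMMED over the blocks, because the straight field legs of all
blocks together see a point at most `N` times (`sum_card_fiber_blk_le`). -/
theorem sum_wfld_blk_le (hN : 1 ≤ N) (μ : Fin 4) (hp : ∀ s, 0 ≤ p s) (Y : Finset Pt) (c : Pt) :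
    ∑ u ∈ Y, wfld (blkW N p) (blkFld (σ := σ) N μ u) c ≤ ((N : ℝ) ^ 4)⁻¹ * ∑ s, p s := by
  classical
  have hn' : (0 : ℝ) < N := by exact_mod_cast hN
  have hP : 0 ≤ ∑ s, p s := Finset.sum_nonneg fun s _ => hp s
  have hwf : ∀ u : Pt, wfld (blkW N p) (blkFld (σ := σ) N μ u) c
      = ((Finset.univ.filter (fun q : ↥(idx N) => N • u + pt μ q.1 = c)).card : ℝ) * (((N : ℝ) ^ 5)⁻¹ * ∑ s, p s) := by
    intro u
    unfold wfld blkW blkFld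
    rw [Finset.sum_filter, Fintype.sum_prod_type]
    have hinner : ∀ q : ↥(idx N), (∑ s : σ, if N • u + pt μ q.1 = c then ((N : ℝ) ^ 5)⁻¹ * p s else 0)
        = if N • u + pt μ q.1 = c then ((N : ℝ) ^ 5)⁻¹ * ∑ s, p s else 0 := fun q => by
      split_ifs with h
      · rw [Finset.mul_sum]
      · simp
    simp_rw [hinner]
    rw [← Finset.sum_filter, Finset.sum_const, nsmul_eq_mul]
  have hcount : (∑ u ∈ Y, ((Finset.univ.filter (fun q : ↥(idx N) => N • u + pt μ q.1 = c)).card : ℝ)) ≤ N := by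
    exact_mod_cast sum_card_fiber_blk_le (μ := μ) Y c
  calc ∑ u ∈ Y, wfld (blkW N p) (blkFld (σ := σ) N μ u) c
      = ∑ u ∈ Y, ((Finset.univ.filter (fun q : ↥(idx N) => N • u + pt μ q.1 = c)).card : ℝ) * (((N : ℝ) ^ 5)⁻¹ * ∑ s, p s) :=
        Finset.sum_congr rfl fun u _ => hwf u
    _ = (∑ u ∈ Y, ((Finset.univ.filter (fun q : ↥(idx N) => N • u + pt μ q.1 = c)).card : ℝ)) * (((N : ℝ) ^ 5)⁻¹ * ∑ s, p s) := by
        rw [Finset.sum_mul]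
    _ ≤ (N : ℝ) * (((N : ℝ) ^ 5)⁻¹ * ∑ s, p s) := mul_le_mul_of_nonneg_right hcount (by positivity)
    _ = ((N : ℝ) ^ 4)⁻¹ * ∑ s, p s := by field_simp

/-- **THE ALL-BLOCKS FIELD-SIDE MASS** ([folklore]): with radial words of length `≤ ℓ₀`,
`Σ_{u∈Y} Σ_{b∈S} ker₁ (blkW N p) (blkFld N μ u) (blkBg N μ u rad id) b c ≤ (ℓ₀+N)·(N⁻⁴·Σ_σ p σ)` for ALL finite `Y`, `S` and every field point `c`
(`sum_ker₁_le_mul_wfld` per block, then `sum_wfld_blk_le`). -/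
theorem sum_sum_ker₁_blk_le (hN : 1 ≤ N) (μ : Fin 4) (hp : ∀ s, 0 ≤ p s) (hrad : ∀ s u x', (rad s u x').length ≤ ℓ₀)
    (Y S : Finset Pt) (c : Pt) :
    ∑ u ∈ Y, ∑ b ∈ S, ker₁ (blkW N p) (blkFld N μ u) (blkBg N μ u rad id) b c ≤ ((ℓ₀ + N : ℕ) : ℝ) * (((N : ℝ) ^ 4)⁻¹ * ∑ s, p s) := by
  calc ∑ u ∈ Y, ∑ b ∈ S, ker₁ (blkW N p) (blkFld N μ u) (blkBg N μ u rad id) b c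
      ≤ ∑ u ∈ Y, ((ℓ₀ + N : ℕ) : ℝ) * wfld (blkW N p) (blkFld N μ u) c :=
        Finset.sum_le_sum fun u _ => sum_ker₁_le_mul_wfld (blkW_nonneg N hp) (length_blkBg_le μ u id (fun s x' => hrad s u x')) S c
    _ = ((ℓ₀ + N : ℕ) : ℝ) * ∑ u ∈ Y, wfld (blkW N p) (blkFld N μ u) c := by rw [Finset.mul_sum]
    _ ≤ ((ℓ₀ + N : ℕ) : ℝ) * (((N : ℝ) ^ 4)⁻¹ * ∑ s, p s) := mul_le_mul_of_nonneg_left (sum_wfld_blk_le hN μ hp Y c) (Nat.cast_nonneg _)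

/-! ## §2 The (MIX-1) field profile summed once, and (M̃Γ) for the block family -/

/-- [folklore] **THE (MIX-1) FIELD PROFILE SUMMED OVER ANY FINITE SET, HALF RATE**: `Σ_{y∈T} ((‖y‖∞+1)⁻² + N⁻²)·e^{−(δ∕(2N))‖y‖∞} ≤ P(δ)·N²`,
`P(δ) = (1 + 80·e^{δ∕4}·(4∕δ)²) + (1 + 480·e^{δ∕4}·(4∕δ)⁴)` (FILE B's `sum_inv_sq_mul_exp_le` (`n²`) and FILE A's `sum_exp_le` (`n⁴`, times `N⁻²`) at rate `δ∕2`). -/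
theorem sum_profile_half_le {δ : ℝ} (hδ : 0 < δ) (hN : 1 ≤ N) (T : Finset Pt) :
    ∑ y ∈ T, (1 / ((supNorm y : ℝ) + 1) ^ 2 + ((N : ℝ) ^ 2)⁻¹) * Real.exp (-(δ / (2 * N)) * (supNorm y : ℝ))
      ≤ ((1 + 80 * Real.exp (δ / 4) * (4 / δ) ^ 2) + (1 + 480 * Real.exp (δ / 4) * (4 / δ) ^ 4)) * (N : ℝ) ^ 2 := by
  have hn' : (0 : ℝ) < N := by exact_mod_cast hN
  have hA := sum_inv_sq_mul_exp_le (δ := δ / 2) (half_pos hδ) hN T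
  have hB := sum_exp_le (δ := δ / 2) (half_pos hδ) hN T
  have e1 : δ / 2 / (N : ℝ) = δ / (2 * N) := by rw [div_div]
  have e2 : δ / 2 / 2 = δ / 4 := by ring
  have e3 : (2 : ℝ) / (δ / 2) = 4 / δ := by field_simp; ring
  rw [e1, e2, e3] at hA hB
  have hsplit : ∑ y ∈ T, (1 / ((supNorm y : ℝ) + 1) ^ 2 + ((N : ℝ) ^ 2)⁻¹) * Real.exp (-(δ / (2 * N)) * (supNorm y : ℝ))
      = ∑ y ∈ T, Real.exp (-(δ / (2 * N)) * (supNorm y : ℝ)) / ((supNorm y : ℝ) + 1) ^ 2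
        + ((N : ℝ) ^ 2)⁻¹ * ∑ y ∈ T, Real.exp (-(δ / (2 * N)) * (supNorm y : ℝ)) := by
    rw [Finset.mul_sum, ← Finset.sum_add_distrib]
    exact Finset.sum_congr rfl fun y _ => by ring
  rw [hsplit]
  calc ∑ y ∈ T, Real.exp (-(δ / (2 * N)) * (supNorm y : ℝ)) / ((supNorm y : ℝ) + 1) ^ 2
        + ((N : ℝ) ^ 2)⁻¹ * ∑ y ∈ T, Real.exp (-(δ / (2 * N)) * (supNorm y : ℝ))
      ≤ (1 + 80 * Real.exp (δ / 4) * (4 / δ) ^ 2) * (N : ℝ) ^ 2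
        + ((N : ℝ) ^ 2)⁻¹ * ((1 + 480 * Real.exp (δ / 4) * (4 / δ) ^ 4) * (N : ℝ) ^ 4) := by
        gcongr
    _ = ((1 + 80 * Real.exp (δ / 4) * (4 / δ) ^ 2) + (1 + 480 * Real.exp (δ / 4) * (4 / δ) ^ 4)) * (N : ℝ) ^ 2 := by
        field_simp

/-- **(M̃Γ) FOR THE ROOTED BLOCK FAMILY** ([folklore]; the Γ₀-profile-windowed FIELD-POINT mass letter `hMt` of
`MixLoopPowerCountingMassGamma.coarse_mix1_secondMoment_le`, for ANY coarse windows `U b′`, ALL finite `S`, `W`, every fine `c`):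
`Σ_{b′∈S} Σ_{w′∈W} ((‖c−(b′+w′)‖∞+1)⁻² + N⁻²)·e^{−(δ∕(2N))‖c−(b′+w′)‖∞}·(Σ_{u′∈U b′} |ker₁^{(u′)} b′ (b′+w′)|) ≤ ((ℓ₀+N)·(N⁻⁴·Σ_σ p σ))·(P(δ)·N²)`
— reindex `w′ ↦ c′ = b′ + w′`, enlarge each field window to `T := S.biUnion (W.image (b′ + ·))` and each coarse window to `S.biUnion U`, swap the sums, bound the
field-side mass at `c′` by `sum_sum_ker₁_blk_le`, then `sum_profile_half_le` ONCE on the reflected window `T.image (c − ·)`.  NO radius letter enters. -/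
theorem windowedFieldMass_blk_le {δ : ℝ} (hδ : 0 < δ) (hN : 1 ≤ N) (μ : Fin 4) (hp : ∀ s, 0 ≤ p s)
    (hrad : ∀ s u x', (rad s u x').length ≤ ℓ₀) (U : Pt → Finset Pt) (W S : Finset Pt) (c : Pt) :
    ∑ b' ∈ S, ∑ w' ∈ W, (1 / ((supNorm (c - (b' + w')) : ℝ) + 1) ^ 2 + ((N : ℝ) ^ 2)⁻¹) *
        Real.exp (-(δ / (2 * N)) * (supNorm (c - (b' + w')) : ℝ)) *
        (∑ u' ∈ U b', |ker₁ (blkW N p) (blkFld N μ u') (blkBg N μ u' rad id) b' (b' + w')|)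
      ≤ (((ℓ₀ + N : ℕ) : ℝ) * (((N : ℝ) ^ 4)⁻¹ * ∑ s, p s)) *
          (((1 + 80 * Real.exp (δ / 4) * (4 / δ) ^ 2) + (1 + 480 * Real.exp (δ / 4) * (4 / δ) ^ 4)) * (N : ℝ) ^ 2) := by
  classical
  have hω := blkW_nonneg N hp
  -- abbreviations: the profile, the enlarged windows, the all-blocks mass
  set prof : Pt → ℝ := fun y => (1 / ((supNorm y : ℝ) + 1) ^ 2 + ((N : ℝ) ^ 2)⁻¹) * Real.exp (-(δ / (2 * N)) * (supNorm y : ℝ))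
    with hprof
  have hprof0 : ∀ y, 0 ≤ prof y := fun y => by rw [hprof]; positivity
  set Y : Finset Pt := S.biUnion U with hY
  set T : Finset Pt := S.biUnion fun b' => W.image (fun w' => b' + w') with hT
  set m : Pt → Pt → ℝ := fun b' c' => ∑ u' ∈ Y, ker₁ (blkW N p) (blkFld N μ u') (blkBg N μ u' rad id) b' c' with hm
  have hm0 : ∀ b' c', 0 ≤ m b' c' := fun b' c' => Finset.sum_nonneg fun u' _ => ker₁_nonneg hω _ _
  -- STEP 1: the inner coarse sum is at most the all-blocks mass over `Y`
  have hinner : ∀ b' ∈ S, ∀ c', ∑ u' ∈ U b', |ker₁ (blkW N p) (blkFld N μ u') (blkBg N μ u' rad id) b' c'| ≤ m b' c' := by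
    intro b' hb' c'
    have habs : ∀ u', |ker₁ (blkW N p) (blkFld N μ u') (blkBg N μ u' rad id) b' c'|
        = ker₁ (blkW N p) (blkFld N μ u') (blkBg N μ u' rad id) b' c' := fun u' => abs_of_nonneg (ker₁_nonneg hω _ _)
    simp only [habs, hm]
    exact Finset.sum_le_sum_of_subset_of_nonneg (by rw [hY]; exact Finset.subset_biUnion_of_mem U hb')
      fun u' _ _ => ker₁_nonneg hω _ _
  -- STEP 2: termwise, then reindex `w' ↦ b' + w'` and enlarge to `T`
  have hrow : ∀ b' ∈ S, ∑ w' ∈ W, prof (c - (b' + w')) *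
        (∑ u' ∈ U b', |ker₁ (blkW N p) (blkFld N μ u') (blkBg N μ u' rad id) b' (b' + w')|)
      ≤ ∑ c' ∈ T, prof (c - c') * m b' c' := by
    intro b' hb'
    calc ∑ w' ∈ W, prof (c - (b' + w')) * (∑ u' ∈ U b', |ker₁ (blkW N p) (blkFld N μ u') (blkBg N μ u' rad id) b' (b' + w')|)
        ≤ ∑ w' ∈ W, prof (c - (b' + w')) * m b' (b' + w') :=
          Finset.sum_le_sum fun w' _ => mul_le_mul_of_nonneg_left (hinner b' hb' _) (hprof0 _)
      _ = ∑ c' ∈ W.image (fun w' => b' + w'), prof (c - c') * m b' c' := by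
          rw [Finset.sum_image (fun x _ y _ h => add_left_cancel h)]
      _ ≤ ∑ c' ∈ T, prof (c - c') * m b' c' :=
          Finset.sum_le_sum_of_subset_of_nonneg
            (by rw [hT]; exact Finset.subset_biUnion_of_mem (fun b' => W.image (fun w' => b' + w')) hb')
            fun c' _ _ => mul_nonneg (hprof0 _) (hm0 _ _)
  -- STEP 3: swap, bound the field-side mass at each `c'` by §1
  have hfield : ∀ c', ∑ b' ∈ S, m b' c' ≤ ((ℓ₀ + N : ℕ) : ℝ) * (((N : ℝ) ^ 4)⁻¹ * ∑ s, p s) := by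
    intro c'
    rw [hm, Finset.sum_comm]
    exact sum_sum_ker₁_blk_le hN μ hp hrad Y S c'
  -- STEP 4: the profile summed once on the reflected window
  have hprofsum : ∑ c' ∈ T, prof (c - c')
      ≤ ((1 + 80 * Real.exp (δ / 4) * (4 / δ) ^ 2) + (1 + 480 * Real.exp (δ / 4) * (4 / δ) ^ 4)) * (N : ℝ) ^ 2 := by
    rw [← Finset.sum_image (s := T) (g := fun c' => c - c') (f := prof) (fun x _ y _ h => sub_right_injective h)]
    have h := sum_profile_half_le hδ hN (T.image fun c' => c - c')
    simpa only [hprof] using h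
  have hK : 0 ≤ ((ℓ₀ + N : ℕ) : ℝ) * (((N : ℝ) ^ 4)⁻¹ * ∑ s, p s) :=
    mul_nonneg (Nat.cast_nonneg _) (mul_nonneg (by positivity) (Finset.sum_nonneg fun s _ => hp s))
  calc ∑ b' ∈ S, ∑ w' ∈ W, prof (c - (b' + w')) *
          (∑ u' ∈ U b', |ker₁ (blkW N p) (blkFld N μ u') (blkBg N μ u' rad id) b' (b' + w')|)
      ≤ ∑ b' ∈ S, ∑ c' ∈ T, prof (c - c') * m b' c' := Finset.sum_le_sum hrow
    _ = ∑ c' ∈ T, prof (c - c') * ∑ b' ∈ S, m b' c' := by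
        rw [Finset.sum_comm]
        exact Finset.sum_congr rfl fun c' _ => by rw [Finset.mul_sum]
    _ ≤ ∑ c' ∈ T, prof (c - c') * (((ℓ₀ + N : ℕ) : ℝ) * (((N : ℝ) ^ 4)⁻¹ * ∑ s, p s)) :=
        Finset.sum_le_sum fun c' _ => mul_le_mul_of_nonneg_left (hfield c') (hprof0 _)
    _ = (((ℓ₀ + N : ℕ) : ℝ) * (((N : ℝ) ^ 4)⁻¹ * ∑ s, p s)) * ∑ c' ∈ T, prof (c - c') := by
        rw [← Finset.sum_mul, mul_comm]
    _ ≤ (((ℓ₀ + N : ℕ) : ℝ) * (((N : ℝ) ^ 4)⁻¹ * ∑ s, p s)) *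
          (((1 + 80 * Real.exp (δ / 4) * (4 / δ) ^ 2) + (1 + 480 * Real.exp (δ / 4) * (4 / δ) ^ 4)) * (N : ℝ) ^ 2) :=
        mul_le_mul_of_nonneg_left hprofsum hK

end Block

end Summit.QuantumFields.BalabanUV.Beta.FP.MixLoopInstanceBlockFamilyField

end
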